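import Summits.QuantumFields.BalabanUV.Beta.GAN24.TaylorRowLamInner
import Summits.QuantumFields.BalabanUV.Beta.GAN24.TaylorSandwich

/-!
# `BalabanUV.Beta.GAN24.TaylorRowLamTable` — binder row G-an2-4 / (CONV-C), S-slot, road «S3-Taylor», Λ SHAPE rows, part 2 of 3:
# THE HYPOTHESES OF THE OWNER'S `TaylorSandwich.sandwich_bound` FOR THE REWRITTEN Λ SANDWICH, AND ITS BOUND

NOT IN PRINT; OUR PROOF ATTEMPT.  HONEST FRAMING (cell contract, verbatim): «discharging `BetaPertH` makes Bałaban's UV stability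
UNCONDITIONAL — a real constructive-QFT result; it is NOT the continuum limit and NOT the Clay problem.»  HONEST DEPENDENCY (verbatim):
«continuum YM on T⁴ ⇐ BetaPertH ∧ nine spine estimates (0/9 proved); BetaPertH ⇐ (D1) ∧ (D4) ∧ CAP+tail; G-an2-4 gates asym, D1 and
NE2/3/4.»  [folklore] bookkeeping over LANDED modules BY NAME; no cited fact, no `def`, no `Prop` mirror; discharges NOTHING of (hS, hSall),
the K-slot or BetaPertH by itself; NOT continuum, NOT Clay.  Unit `b2b-balaban-gan24-formalise-leaf-18` (gen 12; ROW-Λ = SHAPE row S3-L of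
`GAN24/StencilSlotE3OfPieces.e3Shape_of_pieces`, cell journal l.4813), G-an2-4 formalisation swarm, 2026-08-20.

## Contents (generic `d`)
§3 vertex-support radius and lattice-point counting (`l1_sub_zsmul_quo_le`, `l1_zsmul_sub_le_of_mem_box`, `mem_boxY_of_l1_le`), the on-lattice
table's sup ∕ supports ∕ column mass from leaf-11's L2 (`abs_onLat_avgLift_le`, `mem_boxW_of_ne_zero`, `mem_imageY_of_ne_zero`,
`l1_le_of_mem_imageY`, `table_mass_le`), the vertex leg's decay on the TOP block scale (`abs_vertexLeg_le`: `R` read-outs of the top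
multiplier leg, `TaylorLamVertexPairing.abs_contourSumAdj_le_exp` + `quo_quo`); §4a **`abs_sandwich_le`**: the rewritten sandwich of
`TaylorRowLamInner.inner_eq` is bounded by `TaylorSandwich.sandwich_bound` with outer legs in (N1)'s block-`ℓ¹` currency and the top
multiplier leg in the K-slot currency (`CH = N^{d+2}·R·CΦ·N^{−2(d+1)}·e^κ`), radii `RW/N`, `RU/N` free of the level.
-/

noncomputable section

open Finset
open scoped BigOperators
open Literature.MathematicalPhysics.QuantumFieldTheory
open Literature.MathematicalPhysics.QuantumFieldTheory.Balaban1983to89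
open Literature.MathematicalPhysics.QuantumFieldTheory.Balaban1983to89.Beta
open Literature.Probability.LatticeModels (Torus.proj Torus.proj_apply)
open AffineAveraging (Site Form1 unitVec unitVec_apply)
open AffineReproduction (contourSumAdj)
open LatticeForm (quo)
open B12Sec2to5 (l1 l1_nonneg)
open ExpKernelCalculus (MKer Zl BiLoc l1_sub_triangle l1_sub_symm l1_natSmul)
open OneStepResolventKernel (Fib KInv LocStencil proj_zsmul quo_zsmul eq_zsmul_quo_of_proj KInv_inr_inr_coarse)
open KernelSpecInstance (wH wΦ)
open KKTFluctuationKernel (GamΦ)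
open InterLevelTransport (SLam avgLift cwsum cwsum_apply onLat onLat_zsmul onLat_off)
open BalabanStepJets (lamCoeffOf)
open BalabanCompositeJets (lagrInc)
open AveragingHessianKernels (hessFF ell)
open Summit.QuantumFields.BalabanUV.Beta.GAN24.TaylorLamVertexPairing (vertexPair_eq summable_wH_mul_lamCoeffOf quo_quo
  abs_contourSumAdj_le_exp)
open Summit.QuantumFields.BalabanUV.Beta.GAN24.TaylorSandwich (sandwich_bound)
open Summit.QuantumFields.BalabanUV.Beta.GAN24.TaylorMassLam (abs_avgLift_hessFF_le avgLift_hessFF_ne_zero)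
open Summit.QuantumFields.BalabanUV.Beta.GAN24.TaylorBlockSum (abs_ediv_sub_ediv_le nonneg_of_dominated)

namespace Summit.QuantumFields.BalabanUV.Beta.GAN24.TaylorRowLam

variable {d : ℕ}

section Table

variable {Lc : ℕ} [NeZero Lc]

/-! ## §3 The hypotheses of `TaylorSandwich.sandwich_bound` for the rewritten sandwich -/

/-- [folklore] A point and `N′` times its block index differ by less than `N′` per coordinate: `|y − N′•quo N′ y|₁ ≤ (d+1)·N′`. -/
theorem l1_sub_zsmul_quo_le (N' : ℕ) [NeZero N'] (y : Site (d + 1)) :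
    l1 (y - (N' : ℤ) • quo N' y) ≤ ((d : ℝ) + 1) * N' := by
  unfold B12Sec2to5.l1
  have hN : (0 : ℤ) < N' := by exact_mod_cast Nat.pos_of_ne_zero (NeZero.ne N')
  calc ∑ j, |(((y - (N' : ℤ) • quo N' y) j : ℤ) : ℝ)| ≤ ∑ _j : Fin (d + 1), (N' : ℝ) := Finset.sum_le_sum fun j _ => by
        have e : (y - (N' : ℤ) • quo N' y) j = y j % (N' : ℤ) := by
          simp only [Pi.sub_apply, Pi.smul_apply, smul_eq_mul, quo]
          rw [Int.emod_def]
        rw [e]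
        have h0 : 0 ≤ y j % (N' : ℤ) := Int.emod_nonneg _ hN.ne'
        have h1 : y j % (N' : ℤ) < N' := Int.emod_lt_of_pos _ hN
        rw [abs_of_nonneg (by exact_mod_cast h0)]
        exact_mod_cast h1.le
    _ = ((d : ℝ) + 1) * N' := by simp [mul_comm]

/-- [folklore] `ℓ¹` distance from `y` of a lattice point `N′•Y` whose index lies in the sup-norm box of radius `c` around `quo N′ y`:
`≤ (d+1)·N′·(c+1)`. -/
theorem l1_zsmul_sub_le_of_mem_box (N' : ℕ) [NeZero N'] (y Y : Site (d + 1)) (cY : ℕ)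
    (hY : Y ∈ Fintype.piFinset fun j => Finset.Icc (quo N' y j - cY) (quo N' y j + cY)) :
    l1 ((N' : ℤ) • Y - y) ≤ ((d : ℝ) + 1) * N' * (cY + 1) := by
  have h1 : l1 ((N' : ℤ) • Y - (N' : ℤ) • quo N' y) ≤ (N' : ℝ) * (((d : ℝ) + 1) * cY) := by
    rw [← smul_sub, l1_natSmul]
    exact mul_le_mul_of_nonneg_left (l1_le_of_mem_box hY) (Nat.cast_nonneg _)
  have h2 : l1 ((N' : ℤ) • quo N' y - y) ≤ ((d : ℝ) + 1) * N' := by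
    rw [l1_sub_symm]; exact l1_sub_zsmul_quo_le N' y
  have tri := l1_sub_triangle ((N' : ℤ) • Y) ((N' : ℤ) • quo N' y) y
  nlinarith

/-- [folklore] `l1 ≤ R` in two coordinates-free steps: the `Y`-box membership from an `ℓ¹` bound of the lifted support
(`|x − (M·Lc)•Y|₁ ≤ 2(d+1)(Lc+1)M ⇒ Y ∈ box(quo (M·Lc) x, 4(d+1)+1)`), abstracted from `mem_boxY_of_avgLift_ne_zero`. -/
theorem mem_boxY_of_l1_le (M : ℕ) [NeZero M] {x Y : Site (d + 1)}
    (hx : l1 (x - ((M * Lc : ℕ) : ℤ) • Y) ≤ 2 * ((d : ℝ) + 1) * (Lc + 1) * M) :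
    Y ∈ Fintype.piFinset fun j => Finset.Icc (quo (M * Lc) x j - (4 * (d + 1) + 1 : ℕ)) (quo (M * Lc) x j + (4 * (d + 1) + 1 : ℕ)) := by
  have hML : 0 < M * Lc := Nat.mul_pos (Nat.pos_of_ne_zero (NeZero.ne M)) (Nat.pos_of_ne_zero (NeZero.ne Lc))
  rw [Fintype.mem_piFinset]
  intro j
  rw [Finset.mem_Icc]
  have hc : |(((x - ((M * Lc : ℕ) : ℤ) • Y) j : ℤ) : ℝ)| ≤ 2 * ((d : ℝ) + 1) * (Lc + 1) * M :=
    (Finset.single_le_sum (f := fun μ => |(((x - ((M * Lc : ℕ) : ℤ) • Y) μ : ℤ) : ℝ)|) (fun μ _ => abs_nonneg _)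
      (Finset.mem_univ j)).trans hx
  have hq := abs_ediv_sub_ediv_le hML (x j) (((M * Lc : ℕ) : ℤ) * Y j)
  have hYj : ((M * Lc : ℕ) : ℤ) * Y j / ((M * Lc : ℕ) : ℤ) = Y j := by
    rw [mul_comm]; exact Int.mul_ediv_cancel _ (by exact_mod_cast hML.ne')
  rw [hYj] at hq
  have hc' : |(((x j - ((M * Lc : ℕ) : ℤ) * Y j : ℤ)) : ℝ)| ≤ 2 * ((d : ℝ) + 1) * (Lc + 1) * M := by
    simpa only [Pi.sub_apply, Pi.smul_apply, smul_eq_mul] using hc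
  have hML' : (0 : ℝ) < ((M * Lc : ℕ) : ℝ) := by exact_mod_cast hML
  have hratio : 2 * ((d : ℝ) + 1) * (Lc + 1) * M / ((M * Lc : ℕ) : ℝ) ≤ 4 * ((d : ℝ) + 1) := by
    have hM : (0 : ℝ) < M := by exact_mod_cast Nat.pos_of_ne_zero (NeZero.ne M)
    have hL : (1 : ℝ) ≤ Lc := by exact_mod_cast (Nat.one_le_iff_ne_zero.2 (NeZero.ne Lc))
    rw [div_le_iff₀ hML']
    have e : ((M * Lc : ℕ) : ℝ) = (M : ℝ) * Lc := by push_cast; ring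
    rw [e]
    nlinarith [mul_nonneg (show (0 : ℝ) ≤ 2 * ((d : ℝ) + 1) * M by positivity) (show (0 : ℝ) ≤ (Lc : ℝ) - 1 by linarith)]
  have hfin : (((|x j / ((M * Lc : ℕ) : ℤ) - Y j| : ℤ)) : ℝ) ≤ 4 * ((d : ℝ) + 1) + 1 := by
    refine hq.trans ?_
    have := div_le_div_of_nonneg_right hc' hML'.le
    linarith
  have hfin' : |x j / ((M * Lc : ℕ) : ℤ) - Y j| ≤ ((4 * (d + 1) + 1 : ℕ) : ℤ) := by
    have e : (((4 * (d + 1) + 1 : ℕ) : ℤ) : ℝ) = 4 * ((d : ℝ) + 1) + 1 := by push_cast; ring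
    exact_mod_cast (hfin.trans_eq e.symm)
  rw [abs_le] at hfin'
  simp only [quo]
  constructor <;> omega

/-- [folklore] The on-lattice table is bounded like the lifted constraint Hessian: `≤ 2ℓ²/M^{2(d+1)}` (leaf-11's `abs_avgLift_hessFF_le`; `0` off the sublattice). -/
theorem abs_onLat_avgLift_le (N' M : ℕ) [NeZero M] (μ : Fin (d + 1)) (v w y : Site (d + 1)) (a b : Fib d) :
    |onLat N' (fun Y => avgLift M (hessFF Lc μ Y)) v w y a b| ≤ 2 * (ell (d + 1) Lc : ℝ) ^ 2 / (M : ℝ) ^ (2 * (d + 1)) := by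
  by_cases hv : Torus.proj N' v = 0
  · simp only [onLat, hv, if_true]
    exact abs_avgLift_hessFF_le M (Nat.one_le_iff_ne_zero.2 (NeZero.ne Lc)) μ _ w y a b
  · rw [onLat_off _ hv]
    simp only [Pi.zero_apply, abs_zero]
    positivity

/-- [folklore] SUPPORT IN THE FIELD LEG `w`: a nonzero on-lattice table entry has `w` in the sup-norm box of radius `2·(2(d+1)(Lc+1)M)` around `y`
(both fine legs within leaf-11's radius of the same coarse image). -/
theorem mem_boxW_of_ne_zero (N' M : ℕ) [NeZero M] {μ : Fin (d + 1)} {v w y : Site (d + 1)} {a b : Fib d}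
    (h : onLat N' (fun Y => avgLift M (hessFF Lc μ Y)) v w y a b ≠ 0) :
    w ∈ Fintype.piFinset fun j => Finset.Icc (y j - (2 * (2 * (d + 1) * (Lc + 1) * M) : ℕ)) (y j + (2 * (2 * (d + 1) * (Lc + 1) * M) : ℕ)) := by
  by_cases hv : Torus.proj N' v = 0
  · simp only [onLat, hv, if_true] at h
    obtain ⟨hw, hy⟩ := avgLift_hessFF_ne_zero M (Nat.one_le_iff_ne_zero.2 (NeZero.ne Lc)) h
    refine mem_box_of_l1_le y w _ ?_
    have tri := l1_sub_triangle w (((M * Lc : ℕ) : ℤ) • quo N' v) y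
    rw [l1_sub_symm (((M * Lc : ℕ) : ℤ) • quo N' v) y] at tri
    push_cast
    linarith
  · exact absurd (by rw [onLat_off _ hv]; rfl) h

/-- [folklore] SUPPORT IN THE VERTEX VARIABLE `v`: a nonzero on-lattice table entry has `v = N′•Y` with `Y` in the sup-norm box of radius
`4(d+1)+1` around `quo N′ y`. -/
theorem mem_imageY_of_ne_zero (N' M : ℕ) [NeZero M] (hN' : N' = M * Lc) {μ : Fin (d + 1)} {v w y : Site (d + 1)} {a b : Fib d}
    (h : onLat N' (fun Y => avgLift M (hessFF Lc μ Y)) v w y a b ≠ 0) :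
    v ∈ (Fintype.piFinset fun j => Finset.Icc (quo N' y j - (4 * (d + 1) + 1 : ℕ)) (quo N' y j + (4 * (d + 1) + 1 : ℕ))).image
      (fun Y : Site (d + 1) => (N' : ℤ) • Y) := by
  haveI : NeZero N' := ⟨by rw [hN']; exact Nat.mul_ne_zero (NeZero.ne M) (NeZero.ne Lc)⟩
  by_cases hv : Torus.proj N' v = 0
  · simp only [onLat, hv, if_true] at h
    obtain ⟨-, hy⟩ := avgLift_hessFF_ne_zero M (Nat.one_le_iff_ne_zero.2 (NeZero.ne Lc)) h
    rw [Finset.mem_image]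
    refine ⟨quo N' v, ?_, (eq_zsmul_quo_of_proj (d := d) hv).symm⟩
    subst hN'
    exact mem_boxY_of_l1_le (Lc := Lc) M (x := y) (Y := quo (M * Lc) v) hy
  · exact absurd (by rw [onLat_off _ hv]; rfl) h

/-- [folklore] `ℓ¹` RADIUS OF THE VERTEX SUPPORT: `v` in the image box ⇒ `|v − y|₁ ≤ (d+1)·N′·(4(d+1)+2)`. -/
theorem l1_le_of_mem_imageY (N' : ℕ) [NeZero N'] {y v : Site (d + 1)}
    (hv : v ∈ (Fintype.piFinset fun j => Finset.Icc (quo N' y j - (4 * (d + 1) + 1 : ℕ)) (quo N' y j + (4 * (d + 1) + 1 : ℕ))).image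
      (fun Y : Site (d + 1) => (N' : ℤ) • Y)) :
    l1 (v - y) ≤ ((d : ℝ) + 1) * N' * ((4 * (d + 1) + 1 : ℕ) + 1) := by
  rw [Finset.mem_image] at hv
  obtain ⟨Y, hY, rfl⟩ := hv
  exact l1_zsmul_sub_le_of_mem_box N' y Y _ hY

/-- [folklore] COLUMN MASS of the on-lattice table over the two support boxes: `≤ #S_w·(d+1)·(d+1)·#box_Y·2ℓ²/M^{2(d+1)}`. -/
theorem table_mass_le (N' M : ℕ) [NeZero N'] [NeZero M] (y : Site (d + 1)) (l' : Fin (d + 1)) (RWn : ℕ) :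
    ∑ w ∈ (Fintype.piFinset fun j => Finset.Icc (y j - RWn) (y j + RWn)), ∑ l : Fin (d + 1), ∑ μ : Fin (d + 1),
      ∑ v ∈ (Fintype.piFinset fun j => Finset.Icc (quo N' y j - (4 * (d + 1) + 1 : ℕ)) (quo N' y j + (4 * (d + 1) + 1 : ℕ))).image
        (fun Y : Site (d + 1) => (N' : ℤ) • Y),
        |onLat N' (fun Y => avgLift M (hessFF Lc μ Y)) v w y (Sum.inl l) (Sum.inl l')| ≤
      (((2 * RWn + 1) ^ (d + 1) : ℕ) : ℝ) * (((d : ℝ) + 1) * (((d : ℝ) + 1) *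
        ((((2 * (4 * (d + 1) + 1) + 1) ^ (d + 1) : ℕ) : ℝ) * (2 * (ell (d + 1) Lc : ℝ) ^ 2 / (M : ℝ) ^ (2 * (d + 1)))))) := by
  set bnd : ℝ := 2 * (ell (d + 1) Lc : ℝ) ^ 2 / (M : ℝ) ^ (2 * (d + 1)) with hbnd
  set SuY := (Fintype.piFinset fun j => Finset.Icc (quo N' y j - (4 * (d + 1) + 1 : ℕ)) (quo N' y j + (4 * (d + 1) + 1 : ℕ)))
    with hSuY
  have hv : ∀ w (l μ : Fin (d + 1)), ∑ v ∈ SuY.image (fun Y : Site (d + 1) => (N' : ℤ) • Y),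
      |onLat N' (fun Y => avgLift M (hessFF Lc μ Y)) v w y (Sum.inl l) (Sum.inl l')| ≤
        ((((2 * (4 * (d + 1) + 1) + 1) ^ (d + 1) : ℕ) : ℝ)) * bnd := by
    intro w l μ
    calc _ ≤ ∑ _v ∈ SuY.image (fun Y : Site (d + 1) => (N' : ℤ) • Y), bnd :=
          Finset.sum_le_sum fun v _ => abs_onLat_avgLift_le N' M μ v w y _ _
      _ = ((SuY.image (fun Y : Site (d + 1) => (N' : ℤ) • Y)).card : ℝ) * bnd := by rw [Finset.sum_const, nsmul_eq_mul]
      _ ≤ _ := by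
          refine mul_le_mul_of_nonneg_right ?_ (by positivity)
          have h1 := Finset.card_image_le (s := SuY) (f := fun Y : Site (d + 1) => (N' : ℤ) • Y)
          have h2 : SuY.card = (2 * (4 * (d + 1) + 1) + 1) ^ (d + 1) := card_box _ _
          exact_mod_cast (h1.trans h2.le)
  have hμ : ∀ w (l : Fin (d + 1)), ∑ μ : Fin (d + 1), ∑ v ∈ SuY.image (fun Y : Site (d + 1) => (N' : ℤ) • Y),
      |onLat N' (fun Y => avgLift M (hessFF Lc μ Y)) v w y (Sum.inl l) (Sum.inl l')| ≤
        ((d : ℝ) + 1) * (((((2 * (4 * (d + 1) + 1) + 1) ^ (d + 1) : ℕ) : ℝ)) * bnd) := by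
    intro w l
    calc _ ≤ ∑ _μ : Fin (d + 1), ((((2 * (4 * (d + 1) + 1) + 1) ^ (d + 1) : ℕ) : ℝ)) * bnd := Finset.sum_le_sum fun μ _ => hv w l μ
      _ = _ := by simp [mul_comm]
  have hl : ∀ w, ∑ l : Fin (d + 1), ∑ μ : Fin (d + 1), ∑ v ∈ SuY.image (fun Y : Site (d + 1) => (N' : ℤ) • Y),
      |onLat N' (fun Y => avgLift M (hessFF Lc μ Y)) v w y (Sum.inl l) (Sum.inl l')| ≤
        ((d : ℝ) + 1) * (((d : ℝ) + 1) * (((((2 * (4 * (d + 1) + 1) + 1) ^ (d + 1) : ℕ) : ℝ)) * bnd)) := by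
    intro w
    calc _ ≤ ∑ _l : Fin (d + 1), ((d : ℝ) + 1) * (((((2 * (4 * (d + 1) + 1) + 1) ^ (d + 1) : ℕ) : ℝ)) * bnd) :=
          Finset.sum_le_sum fun l _ => hμ w l
      _ = _ := by simp [mul_comm]
  calc _ ≤ ∑ _w ∈ (Fintype.piFinset fun j => Finset.Icc (y j - RWn) (y j + RWn)),
        ((d : ℝ) + 1) * (((d : ℝ) + 1) * (((((2 * (4 * (d + 1) + 1) + 1) ^ (d + 1) : ℕ) : ℝ)) * bnd)) :=
        Finset.sum_le_sum fun w _ => hl w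
    _ = _ := by rw [Finset.sum_const, nsmul_eq_mul, card_box]

/-- [folklore] THE VERTEX LEG OF THE REWRITTEN SANDWICH decays from the source block on the TOP block scale: for `N = N′·R` and
`|wΦ_N κ κ′ q| ≤ CΦ·e^{−κ|q|₁}`, `|onLat N′ (e·𝒬ᵀ_R Φ̃) v| ≤ |e|·R·CΦ·e^{κ}·e^{−κ|quo N v − u′|₁}`. -/
theorem abs_vertexLeg_le {N N' R : ℕ} [NeZero N] [NeZero N'] (hN : N = N' * R) (κ' μ : Fin (d + 1)) (u' v : Site (d + 1))
    (e : ℝ) {CΦ κ : ℝ} (hκ : 0 ≤ κ) (hCΦ : 0 ≤ CΦ) (hΦ : ∀ κ₁ q, |wΦ (N := N) κ₁ κ' q| ≤ CΦ * Real.exp (-κ * l1 q)) :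
    |onLat N' (fun Y => e * contourSumAdj R (fun κ₁ q => wΦ (N := N) κ₁ κ' (q - u')) μ Y) v| ≤
      |e| * (R * (CΦ * Real.exp κ)) * Real.exp (-κ * l1 (quo N v - u')) := by
  have hR : NeZero R := ⟨by rintro rfl; exact NeZero.ne N (by rw [hN, mul_zero])⟩
  by_cases hv : Torus.proj N' v = 0
  · simp only [onLat, hv, if_true, abs_mul]
    have h := abs_contourSumAdj_le_exp R (fun κ₁ q => wΦ (N := N) κ₁ κ' (q - u')) u' hκ (fun κ₁ q => hΦ κ₁ (q - u')) μ (quo N' v)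
    rw [quo_quo, ← hN] at h
    calc |e| * |contourSumAdj R (fun κ₁ q => wΦ (N := N) κ₁ κ' (q - u')) μ (quo N' v)|
        ≤ |e| * (R * (CΦ * Real.exp κ * Real.exp (-κ * l1 (quo N v - u')))) := mul_le_mul_of_nonneg_left h (abs_nonneg e)
      _ = _ := by ring
  · rw [onLat_off _ hv, abs_zero]
    positivity

/-! ## §4a The rewritten sandwich is bounded -/

/-- [folklore] **THE REWRITTEN SANDWICH IS BOUNDED** by the owner's `TaylorSandwich.sandwich_bound`: outer legs in (N1)'s block-`ℓ¹`
currency (`CA`, `CB`), vertex leg `= onLat (N^{d+2}·𝒬ᵀ_R Φ̃_N)` (`R` read-outs of the top multiplier leg: `CH = N^{d+2}·R·CΦ·N^{−2(d+1)}·e^κ`),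
table `= onLat (avgLift M ∘ hessFF Lc μ)` (leaf-11's sup × the two support boxes: `Mass`), radii `RW/N`, `RU/N` bounded free of the level. -/
theorem abs_sandwich_le (ℓ k p : ℕ) (hp : p = ℓ + k + 1) {κ CA CB CΦ : ℝ} (hκ : 0 < κ) (hCΦ : 0 ≤ CΦ)
    (hA : ∀ (α l : Fin (d + 1)) (x' w : Site (d + 1)),
      |((Lc : ℝ) ^ p) ^ (d + 2) * GamΦ (N := Lc ^ p) α x' l w| ≤
        CA * Real.exp (-κ * l1 (x' - quo (Lc ^ p) w)))
    (hB : ∀ (κ₁ l : Fin (d + 1)) (z : Site (d + 1)),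
      |((Lc : ℝ) ^ p) ^ (d + 2) * wH (N := Lc ^ p) κ₁ l z| ≤ CB * Real.exp (-κ * l1 (quo (Lc ^ p) z)))
    (hΦ : ∀ (κ₁ l : Fin (d + 1)) (y : Site (d + 1)),
      |((Lc : ℝ) ^ p) ^ (2 * (d + 1)) * wΦ (N := Lc ^ p) κ₁ l y| ≤ CΦ * Real.exp (-κ * l1 y))
    (κ' : Fin (d + 1)) (u' x' z' : Site (d + 1)) (α β : Fin (d + 1)) :
    |∑' y : Site (d + 1), ∑ l' : Fin (d + 1),
        (∑' w : Site (d + 1), ∑ l : Fin (d + 1),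
            ((((Lc ^ p : ℕ) : ℝ)) ^ (d + 2) * GamΦ (N := Lc ^ p) α x' l w) *
              ∑ μ : Fin (d + 1), ((((Lc ^ p : ℕ) : ℝ)) ^ (d + 1))⁻¹ * ∑' v : Site (d + 1),
                onLat (Lc ^ (ℓ + 1)) (fun Y => (((Lc ^ p : ℕ) : ℝ)) ^ (d + 2) *
                    contourSumAdj (Lc ^ k) (fun κ₁ q => wΦ (N := Lc ^ p) κ₁ κ' (q - u')) μ Y) v *
                  onLat (Lc ^ (ℓ + 1)) (fun Y => avgLift (Lc ^ ℓ) (hessFF Lc μ Y)) v w y (Sum.inl l) (Sum.inl l')) *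
          ((((Lc ^ p : ℕ) : ℝ)) ^ (d + 2) * wH (N := Lc ^ p) l' β (y - ((Lc ^ p : ℕ) : ℤ) • z'))| ≤
      ((d : ℝ) + 1) * (CA * CB *
          ((((Lc ^ p : ℕ) : ℝ)) ^ (d + 2) * ((Lc : ℝ) ^ k * ((CΦ * (((Lc : ℝ) ^ p) ^ (2 * (d + 1)))⁻¹) * Real.exp κ))) *
          ((((2 * (2 * (2 * (d + 1) * (Lc + 1) * Lc ^ ℓ)) + 1) ^ (d + 1) : ℕ) : ℝ) * (((d : ℝ) + 1) * (((d : ℝ) + 1) *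
            ((((2 * (4 * (d + 1) + 1) + 1) ^ (d + 1) : ℕ) : ℝ) * (2 * (ell (d + 1) Lc : ℝ) ^ 2 / ((Lc : ℝ) ^ ℓ) ^ (2 * (d + 1))))))) *
          (Real.exp (κ * (((d : ℝ) + 1) * (4 * ((d : ℝ) + 1) * (Lc + 1)) + (d + 1))) *
            Real.exp (κ * (((d : ℝ) + 1) * ((4 * ((d : ℝ) + 1) + 1) + 1) + (d + 1))))) *
        Zl (d + 1) (κ / 2) * Real.exp (-(κ / 2) * (l1 (x' - u') + l1 (z' - u'))) := by
  subst hp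
  have hL0 : (0 : ℝ) < Lc := by exact_mod_cast Nat.pos_of_ne_zero (NeZero.ne Lc)
  have hL1 : (1 : ℝ) ≤ Lc := by exact_mod_cast (Nat.one_le_iff_ne_zero.2 (NeZero.ne Lc))
  haveI hN0 : NeZero (Lc ^ (ℓ + k + 1)) := ⟨pow_ne_zero _ (NeZero.ne Lc)⟩
  haveI hNp0 : NeZero (Lc ^ (ℓ + 1)) := ⟨pow_ne_zero _ (NeZero.ne Lc)⟩
  haveI hM0 : NeZero (Lc ^ ℓ) := ⟨pow_ne_zero _ (NeZero.ne Lc)⟩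
  have hNR : Lc ^ (ℓ + k + 1) = Lc ^ (ℓ + 1) * Lc ^ k := by rw [← pow_add]; ring_nf
  have hNp : Lc ^ (ℓ + 1) = Lc ^ ℓ * Lc := pow_succ Lc ℓ
  have hcast : (((Lc ^ (ℓ + k + 1) : ℕ) : ℝ)) = (Lc : ℝ) ^ (ℓ + k + 1) := by push_cast; rfl
  have hcastP : (((Lc ^ (ℓ + 1) : ℕ) : ℝ)) = (Lc : ℝ) ^ (ℓ + 1) := by push_cast; rfl
  have hcastM : (((Lc ^ ℓ : ℕ) : ℝ)) = (Lc : ℝ) ^ ℓ := by push_cast; rfl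
  have hcastR : (((Lc ^ k : ℕ) : ℝ)) = (Lc : ℝ) ^ k := by push_cast; rfl
  set RWn : ℕ := 2 * (2 * (d + 1) * (Lc + 1) * Lc ^ ℓ) with hRWn
  set RW : ℝ := ((d : ℝ) + 1) * (4 * ((d : ℝ) + 1) * (Lc + 1)) * ((Lc ^ (ℓ + k + 1) : ℕ) : ℝ) with hRW
  set RU : ℝ := ((d : ℝ) + 1) * ((4 * ((d : ℝ) + 1) + 1) + 1) * ((Lc ^ (ℓ + k + 1) : ℕ) : ℝ) with hRU
  -- the legs in the `ℕ`-cast currency of `sandwich_bound`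
  have hA' : ∀ (l : Fin (d + 1)) (w : Site (d + 1)),
      |((Lc ^ (ℓ + k + 1) : ℕ) : ℝ) ^ (d + 2) * GamΦ (N := Lc ^ (ℓ + k + 1)) α x' l w| ≤
        CA * Real.exp (-κ * l1 (x' - quo (Lc ^ (ℓ + k + 1)) w)) := fun l w => by
    rw [hcast]; exact hA α l x' w
  have hB' : ∀ (l' : Fin (d + 1)) (y : Site (d + 1)),
      |((Lc ^ (ℓ + k + 1) : ℕ) : ℝ) ^ (d + 2) * wH (N := Lc ^ (ℓ + k + 1)) l' β (y - ((Lc ^ (ℓ + k + 1) : ℕ) : ℤ) • z')| ≤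
        CB * Real.exp (-κ * l1 (quo (Lc ^ (ℓ + k + 1)) y - z')) := fun l' y => by
    have hq : quo (Lc ^ (ℓ + k + 1)) (y - ((Lc ^ (ℓ + k + 1) : ℕ) : ℤ) • z') = quo (Lc ^ (ℓ + k + 1)) y - z' := by
      rw [sub_eq_add_neg y, ← smul_neg, BlochFibreUniqueness.quo_add_zsmul, ← sub_eq_add_neg]
    rw [hcast, ← hq]
    exact hB l' β _
  have hΦ' : ∀ κ₁ q, |wΦ (N := Lc ^ (ℓ + k + 1)) κ₁ κ' q| ≤
      CΦ * (((Lc : ℝ) ^ (ℓ + k + 1)) ^ (2 * (d + 1)))⁻¹ * Real.exp (-κ * l1 q) := by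
    intro κ₁ q
    have hpow : (0 : ℝ) < ((Lc : ℝ) ^ (ℓ + k + 1)) ^ (2 * (d + 1)) := by positivity
    have h := hΦ κ₁ κ' q
    rw [abs_mul, abs_of_pos hpow] at h
    calc |wΦ (N := Lc ^ (ℓ + k + 1)) κ₁ κ' q|
        = (((Lc : ℝ) ^ (ℓ + k + 1)) ^ (2 * (d + 1)))⁻¹ *
            ((((Lc : ℝ) ^ (ℓ + k + 1)) ^ (2 * (d + 1))) * |wΦ (N := Lc ^ (ℓ + k + 1)) κ₁ κ' q|) := by
          rw [← mul_assoc, inv_mul_cancel₀ hpow.ne', one_mul]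
      _ ≤ (((Lc : ℝ) ^ (ℓ + k + 1)) ^ (2 * (d + 1)))⁻¹ * (CΦ * Real.exp (-κ * l1 q)) :=
          mul_le_mul_of_nonneg_left h (by positivity)
      _ = _ := by ring
  have hH' : ∀ (μ : Fin (d + 1)) (v : Site (d + 1)),
      |onLat (Lc ^ (ℓ + 1)) (fun Y => ((Lc ^ (ℓ + k + 1) : ℕ) : ℝ) ^ (d + 2) *
          contourSumAdj (Lc ^ k) (fun κ₁ q => wΦ (N := Lc ^ (ℓ + k + 1)) κ₁ κ' (q - u')) μ Y) v| ≤
        (|(((Lc ^ (ℓ + k + 1) : ℕ) : ℝ)) ^ (d + 2)| * ((Lc ^ k : ℕ) * ((CΦ * (((Lc : ℝ) ^ (ℓ + k + 1)) ^ (2 * (d + 1)))⁻¹) * Real.exp κ))) *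
          Real.exp (-κ * l1 (quo (Lc ^ (ℓ + k + 1)) v - u')) := fun μ v =>
    abs_vertexLeg_le (d := d) hNR κ' μ u' v (((Lc ^ (ℓ + k + 1) : ℕ) : ℝ) ^ (d + 2)) hκ.le
      (by positivity) hΦ'
  have hS := sandwich_bound (d := d) (N := Lc ^ (ℓ + k + 1)) (κ := κ) (CA := CA) (CB := CB)
    (CH := |(((Lc ^ (ℓ + k + 1) : ℕ) : ℝ)) ^ (d + 2)| * ((Lc ^ k : ℕ) * ((CΦ * (((Lc : ℝ) ^ (ℓ + k + 1)) ^ (2 * (d + 1)))⁻¹) * Real.exp κ)))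
    (Mass := (((2 * RWn + 1) ^ (d + 1) : ℕ) : ℝ) * (((d : ℝ) + 1) * (((d : ℝ) + 1) *
      ((((2 * (4 * (d + 1) + 1) + 1) ^ (d + 1) : ℕ) : ℝ) * (2 * (ell (d + 1) Lc : ℝ) ^ 2 / (((Lc ^ ℓ : ℕ) : ℝ)) ^ (2 * (d + 1)))))))
    (RW := RW) (RU := RU) (x' := x') (u' := u') (z' := z')
    (A := fun l w => ((Lc ^ (ℓ + k + 1) : ℕ) : ℝ) ^ (d + 2) * GamΦ (N := Lc ^ (ℓ + k + 1)) α x' l w)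
    (B := fun l' y => ((Lc ^ (ℓ + k + 1) : ℕ) : ℝ) ^ (d + 2) * wH (N := Lc ^ (ℓ + k + 1)) l' β (y - ((Lc ^ (ℓ + k + 1) : ℕ) : ℤ) • z'))
    (H := fun μ v => onLat (Lc ^ (ℓ + 1)) (fun Y => ((Lc ^ (ℓ + k + 1) : ℕ) : ℝ) ^ (d + 2) *
      contourSumAdj (Lc ^ k) (fun κ₁ q => wΦ (N := Lc ^ (ℓ + k + 1)) κ₁ κ' (q - u')) μ Y) v)
    (T := fun μ v w l y l' => onLat (Lc ^ (ℓ + 1)) (fun Y => avgLift (Lc ^ ℓ) (hessFF Lc μ Y)) v w y (Sum.inl l) (Sum.inl l'))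
    (Sw := fun y => Fintype.piFinset fun j => Finset.Icc (y j - RWn) (y j + RWn))
    (Su := fun y => (Fintype.piFinset fun j =>
        Finset.Icc (quo (Lc ^ (ℓ + 1)) y j - (4 * (d + 1) + 1 : ℕ)) (quo (Lc ^ (ℓ + 1)) y j + (4 * (d + 1) + 1 : ℕ))).image
      (fun Y : Site (d + 1) => ((Lc ^ (ℓ + 1) : ℕ) : ℤ) • Y))
    hκ hA' hB' hH'
    (fun μ v w l y l' hne => mem_boxW_of_ne_zero (Lc := Lc) (Lc ^ (ℓ + 1)) (Lc ^ ℓ) hne)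
    (fun μ v w l y l' hne => mem_imageY_of_ne_zero (Lc := Lc) (Lc ^ (ℓ + 1)) (Lc ^ ℓ) hNp hne)
    (fun y w hw => by
      have h := l1_le_of_mem_box hw
      have hle : ((d : ℝ) + 1) * RWn ≤ RW := by
        rw [hRW, hRWn, hcast]
        push_cast
        have hmono : ((Lc : ℝ) ^ ℓ) ≤ (Lc : ℝ) ^ (ℓ + k + 1) := pow_le_pow_right₀ hL1 (by omega)
        nlinarith [hmono, show (0 : ℝ) ≤ ((d : ℝ) + 1) * (4 * ((d : ℝ) + 1) * (Lc + 1)) by positivity]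
      exact h.trans hle)
    (fun y v hv => by
      have h := l1_le_of_mem_imageY (d := d) (Lc ^ (ℓ + 1)) hv
      have hle : ((d : ℝ) + 1) * ((Lc ^ (ℓ + 1) : ℕ) : ℝ) * ((4 * (d + 1) + 1 : ℕ) + 1) ≤ RU := by
        rw [hRU, hcastP, hcast]
        push_cast
        have hmono : ((Lc : ℝ) ^ (ℓ + 1)) ≤ (Lc : ℝ) ^ (ℓ + k + 1) := pow_le_pow_right₀ hL1 (by omega)
        nlinarith [hmono, show (0 : ℝ) ≤ ((d : ℝ) + 1) * ((4 * ((d : ℝ) + 1) + 1) + 1) by positivity]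
      exact h.trans hle)
    (fun y l' => table_mass_le (Lc := Lc) (Lc ^ (ℓ + 1)) (Lc ^ ℓ) y l' RWn)
  -- cancel `RW/N`, `RU/N` and display the constants through `(Lc:ℝ)` powers
  have hNpos : (0 : ℝ) < ((Lc ^ (ℓ + k + 1) : ℕ) : ℝ) := by rw [hcast]; positivity
  have hRW' : RW / ((Lc ^ (ℓ + k + 1) : ℕ) : ℝ) = ((d : ℝ) + 1) * (4 * ((d : ℝ) + 1) * (Lc + 1)) := by
    rw [hRW]; field_simp
  have hRU' : RU / ((Lc ^ (ℓ + k + 1) : ℕ) : ℝ) = ((d : ℝ) + 1) * ((4 * ((d : ℝ) + 1) + 1) + 1) := by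
    rw [hRU]; field_simp
  have hCHabs : |(((Lc ^ (ℓ + k + 1) : ℕ) : ℝ)) ^ (d + 2)| = (((Lc ^ (ℓ + k + 1) : ℕ) : ℝ)) ^ (d + 2) :=
    abs_of_pos (pow_pos hNpos _)
  rw [hRW', hRU', hCHabs, hcastR, hcastM] at hS
  exact hS

end Table

end Summit.QuantumFields.BalabanUV.Beta.GAN24.TaylorRowLam
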